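import Literature.NumberTheory.IwasawaTheory.FukudaElementaryLayerAlgebraSubOne
import Literature.NumberTheory.IwasawaTheory.Fukuda1994Thm1RankPackageFixedEq
import Literature.NumberTheory.IwasawaTheory.ClassGroupPRankLeOfNotElementaryLayer
import HarnessLib

/-!
# THE ELEMENTARY-LAYER DOOR OVER A BASE WITH `ord_p h_K = 1`: Fukuda index `0`, `e_0 = 1`, and at the layer `K_{k+1}` AT MOST `p` ambiguous `p`-classes
# (`p² ∤ #Cl(K_{k+1})^{Gal(K_{k+1}/K)}` — Chevalley with maximal unit norm index); then `rank_p Cl(K_k) < ord_p h(K_k)` OR `rank_p Cl(K_k) < p^k`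
# (in particular `ord_p h(K_k) ≠ p^k`) forces `rank_p Cl(K_m) ≤ p^k − 1` for EVERY `m`, `μ = 0`, `λ ≤ p^k − 1` (proved, finite level)

`Proofs`-style file (theorems only: no definition, no named fact, no instance, no `sorry`) in topic `NumberTheory/IwasawaTheory` (namespace = path), written by the
prover seat `bsd-line-att-p3` g47 (cell `bsd-f1-sign2`, WIDTH-5 attach on route `AlignedTransportAtTwo`; `--supports` stmt-BirchSwinnertonDyer-22298, closes nothing; no
class group is computed here; BSD is not advanced by this file).  Companion of `ClassGroupPRankLeOfNotElementaryLayer` (same seat: the case `p ∤ h_K`, `e_1 ≤ 1`).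

THE THEOREM (`classGroupPRank_add_le_of_not_sq_dvd_card_fixed`, stated over a base LAYER `K_n` with Fukuda index `n₀ ≤ n`).  `κ` a `ℤ_p`-extension of the number field `K` with Fukuda's index `0`,
`e_j = ord_p h(K_j)`, `r_j = rank_p Cl(K_j)`.  IF `e_0 = 1`, `p²` does NOT divide the number of classes of `K_{k+1}` fixed by `Gal(K_{k+1}/K)`, AND `r_k < e_k` (the
`p`-class group of `K_k` is NOT elementary abelian) — or instead `r_k < p^k` — THEN **`r_m ≤ p^k − 1` for every `m`, `μ = 0`, `λ ≤ p^k − 1`**.  Hence the CLASS-NUMBER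
TEST `classicalMuVanishes_and_classicalLambda_le_of_classNumberPExp_ne_pow`: **`e_k ≠ p^k` ⟹ the same**; contrapositive: over such a base `μ > 0` forces
`e_k = r_k = p^k`, `Cl(K_k)[p^∞] ≅ (ℤ/p)^{p^k}`, at every layer below the ambiguous-class hypothesis.

WHY (Washington §13.3: `#X/Y₀ = p^{e_0} = p` and `TX ⊆ Y₀`; the ambiguous-class bound at the top layer says `#A/TA = #A^g ≤ p`, so `Y₀ = TA`, `A_j = A/ν_jTA`, and `X = Λ/J`
is cyclic with `J + (T) = 𝔪` — the SAME «depth one» shape as the hard core of the companion file, with `ν_jT ≡ T^{p^j}` in place of `ν_j ≡ T^{p^j−1}`).  At finite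
level: the package WITH THE EXACT AMBIGUOUS-CLASS COUNT `exists_layer_package_fixed_eq` (same seat: `#{a ∈ A : gag⁻¹ = a} = p^{v_p #Cl(K_t)^σ}`, an EQUALITY — g42's
`PackageFixed` had only `≥`) at `t = k + 1`, `e_0 = 1` gives `#A/Y₀ = p`, `Y₀ ⊇ TA` (tree `FukudaGroup.map_sub_one_mem_subOf_commutator_sup`), the count gives `#A/TA ≤ p`, so
`Y₀ = TA`; the algebra `FukudaElementary.card_quotient_smul_le_of_card_quotient_sub_one_le` / `…_of_card_quotient_sup_lt_pow` bounds `#(A/pA) ≤ p^{p^k−1}`, i.e.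
`r_{k+1} ≤ p^k − 1 < p^{k+1} − 1`, and the tree's door L10 propagates the bound to every layer.

CURRENCY.  The ambiguous-class hypothesis at `K_{k+1}` is a Chevalley count: for two totally ramified primes and `[E_K : E_K ∩ N_{K_{k+1}/K}K_{k+1}ˣ] = p^{k+1}` (maximal
unit norm index) `#Cl(K_{k+1})^G = h_K`, so `p² ∤` it iff `p² ∤ h_K`; kernel-certifiable at `p = 2`, `k = 1` by TWO dyadic residues (`ε, ε² ∉ N_{K_2/K}K_2ˣ`, tree
`CyclotomicTwoLayerTwoNonNormUnit`).  HONEST SCOPE: classical genus theory + Fukuda; nothing specific to any summit; BSD is not advanced by this file.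
Not found in print in this form; ingredients cited at each use (D-0014).

References: [Washington1997] L. Washington, *Introduction to Cyclotomic Fields*, 2nd ed., §13.3 Lemmas 13.15, 13.18, Prop. 13.22–13.23;
[Fukuda1994] T. Fukuda, *Remarks on ℤ_p-extensions of number fields*, Proc. Japan Acad. 70 A (1994), Thm. 1 and its proof, p. 264;
[Lang1990] S. Lang, *Cyclotomic Fields I and II*, Ch. 5 §1–§2, Ch. 13 §4; [NeukirchANT1999] Ch. IV §6, Ch. VI §7 Thm. (7.1).
-/

set_option autoImplicit false

noncomputable section

open scoped NumberField IsMulCommutative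
open NumberField Field Finset

namespace Literature.NumberTheory.IwasawaTheory

open Literature.NumberTheory.EllipticCurves Literature.NumberTheory.NumberFields

variable {K : Type} [Field K] [NumberField K] {p : ℕ} [hp : Fact p.Prime]

/-! ## §1 Inside the package with the exact ambiguous-class count -/

variable {F L : Type*} [Field F] [Field L] [NumberField L] [Algebra F L] [Finite (L ≃ₐ[F] L)] in
/-- If `σ` satisfies `cond` and every automorphism satisfying `cond` is a power of `σ`, the classes fixed by all `τ` with `cond τ` are exactly the classes fixed by `σ`
(re-proved: private in `ClassGroupPRankLeOneOfAmbiguousLayerTwo`). [folklore] -/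
private theorem card_fixed_eq_card_fixed_of_generator' (cond : (L ≃ₐ[F] L) → Prop) (σ : L ≃ₐ[F] L) (hσ : cond σ)
    (hgen : ∀ τ : L ≃ₐ[F] L, cond τ → τ ∈ Subgroup.zpowers σ) :
    Nat.card {c : ClassGroup (𝓞 L) // ∀ τ : L ≃ₐ[F] L, cond τ → ClassGroup.mulEquiv (AmbiguousClass.intAut τ) c = c} =
      Nat.card {c : ClassGroup (𝓞 L) // ClassGroup.mulEquiv (AmbiguousClass.intAut σ) c = c} := by
  refine Nat.card_congr (Equiv.subtypeEquivRight fun c => ⟨fun h => h σ hσ, fun h τ hτ => ?_⟩)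
  obtain ⟨k, rfl⟩ := (Submonoid.mem_powers_iff _ _).mp (mem_powers_iff_mem_zpowers.mpr (hgen τ hτ))
  clear hτ
  induction k with
  | zero => rw [pow_zero, AmbiguousClass.mulEquiv_intAut_one, MulEquiv.refl_apply]
  | succ k ih => rw [pow_succ, AmbiguousClass.mulEquiv_intAut_mul, MulEquiv.trans_apply, h, ih]

/-- Every `K`-automorphism of a layer fixes `K_0 = K` pointwise (re-proved: private in `ClassGroupPRankLeOneOfAmbiguousLayerTwo`). [folklore] -/
private theorem forall_apply_eq_of_mem_layer_zero' (κ : ZpExtension K p) (m : ℕ) (τ : (κ.layer m) ≃ₐ[K] (κ.layer m))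
    (y : κ.layer m) (hy : ((y : κ.layer m) : AlgebraicClosure K) ∈ κ.layer 0) : τ y = y := by
  rw [κ.layer_zero, IntermediateField.mem_bot] at hy
  obtain ⟨k, hk⟩ := hy
  have : y = algebraMap K (κ.layer m) k := Subtype.ext hk.symm
  rw [this, AlgEquiv.commutes]

/-- `#(M/f(M)) = #ker f` for an endomorphism of a finite abelian group. [folklore] -/
private theorem card_quotient_range_eq_card_ker'' {M : Type*} [AddCommGroup M] [Finite M] (f : Module.End ℤ M) :
    Nat.card (M ⧸ LinearMap.range f) = Nat.card (LinearMap.ker f) := by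
  have h1 : Nat.card (LinearMap.ker f) * Nat.card (LinearMap.range f) = Nat.card M := by
    rw [← Nat.card_congr (LinearMap.quotKerEquivRange f).toEquiv]
    exact (Submodule.card_eq_card_quotient_mul_card (LinearMap.ker f)).symm
  have h2 : Nat.card (LinearMap.range f) * Nat.card (M ⧸ LinearMap.range f) = Nat.card M :=
    (Submodule.card_eq_card_quotient_mul_card (LinearMap.range f)).symm
  have hpos : 0 < Nat.card (LinearMap.range f) := Nat.card_pos
  apply Nat.eq_of_mul_eq_mul_left hpos
  rw [h2, ← h1, mul_comm]

/-- The finite-level step: in the package of `K_n ⊆ K_{n+t} ⊆ H_p(K_{n+t})` with the EXACT ambiguous-class count, `e_n = 1` and `p² ∤ #Cl(K_{n+t})^{Gal(K_{n+t}/K_n)}`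
give `Y₀ = TA`, `#A/TA ≤ p`; then `r_{n+k} < e_{n+k}`, or `r_{n+k} < p^k`, or `p^k < e_{n+k}` (some `k ≤ t`) gives `r_{n+m} ≤ p^k − 1` for every `m ≤ t`.
[cite: Washington1997, §13.3 Lemmas 13.15, 13.18 and Prop. 13.22] [cite: Fukuda1994, Thm. 1 (proof, p. 264)] [cite: NeukirchANT1999, Ch. VI §7 Thm. (7.1)] -/
private theorem layer_subOne (κ : ZpExtension K p) {n₀ n : ℕ} (hκ : TotallyRamifiedFrom κ n₀) (hn : n₀ ≤ n)
    (h0 : classNumberPExp κ n = 1) {t : ℕ} (ht : 1 ≤ t)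
    (hfix : ¬ p ^ 2 ∣ Nat.card {c : ClassGroup (𝓞 (κ.layer (n + t))) //
        ∀ τ : (κ.layer (n + t)) ≃ₐ[K] (κ.layer (n + t)),
          (∀ y : κ.layer (n + t), ((y : κ.layer (n + t)) : AlgebraicClosure K) ∈ κ.layer n → τ y = y) →
            ClassGroup.mulEquiv (AmbiguousClass.intAut τ) c = c})
    {k : ℕ} (hkt : k ≤ t)
    (hk : classGroupPRank κ (n + k) < classNumberPExp κ (n + k) ∨ classGroupPRank κ (n + k) < p ^ k ∨
      p ^ k < classNumberPExp κ (n + k))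
    {m : ℕ} (hmt : m ≤ t) :
    classGroupPRank κ (n + m) ≤ p ^ k - 1 := by
  classical
  have hp1 : 1 < p := hp.out.one_lt
  haveI : FiniteDimensional K (κ.layer (n + t)) := κ.finiteDimensional_layer_holds (n + t)
  haveI : NumberField (κ.layer (n + t)) := NumberField.of_module_finite K _
  haveI : Finite ((κ.layer (n + t)) ≃ₐ[K] (κ.layer (n + t))) := inferInstance
  obtain ⟨G, _instG, _instF, A', hA'n, _instC, g, 𝓘, hgA, hgen, hA'index, h𝓘, hg𝓘, hA'card, ⟨σ, hσfix, hσgen, hcount⟩, hlayer⟩ :=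
    exists_layer_package_fixed_eq κ hκ hn t ht
  set Y : Submodule ℤ (Additive A') := FukudaGroup.subOf A' (⁅(⊤ : Subgroup G), ⊤⁆ ⊔ ⨆ I ∈ 𝓘, I) with hY
  set φ : Module.End ℤ (Additive A') := FukudaGroup.conjEnd A' g with hφ
  set P : Submodule ℤ (Additive A') := (⊤ : Submodule ℤ (Additive A')).map ((p : ℤ) • (1 : Module.End ℤ (Additive A')))
    with hP
  have hφt : φ ^ p ^ t = 1 := FukudaGroup.conjEnd_pow_index_eq_one hgA hgen hA'index
  have hM : ∃ a : ℕ, Nat.card (Additive A') = p ^ a := ⟨_, hA'card⟩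
  -- `#(A/ν_i Y) = p^{e_{n+i}}` and `#(A/(ν_i Y + pA)) = p^{r_{n+i}}`
  have hquotE : ∀ {i : ℕ} (_ : i ≤ t) {Gi : Subgroup G} (_ : A' ≤ Gi) (_ : Gi.index = p ^ i),
      (⁅Gi, Gi⁆ ⊔ ⨆ I ∈ 𝓘, I ⊓ Gi).relIndex Gi = Nat.card (Additive A' ⧸ Y.map (∑ l ∈ range (p ^ i), φ ^ l)) := by
    intro i hi Gi hAGi hGi
    have hmul := FukudaGroup.relIndex_commutator_sup_layer_mul_card hgA hgen hA'index h𝓘 hg𝓘 hi hAGi hGi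
    have hcard : Nat.card A' = Nat.card ↥(Y.map (∑ l ∈ range (p ^ i), φ ^ l)) *
        Nat.card (Additive A' ⧸ Y.map (∑ l ∈ range (p ^ i), φ ^ l)) :=
      Submodule.card_eq_card_quotient_mul_card (Y.map (∑ l ∈ range (p ^ i), φ ^ l))
    rw [hcard, mul_comm (Nat.card ↥(Y.map _))] at hmul
    exact Nat.eq_of_mul_eq_mul_right Nat.card_pos hmul
  have hquotR : ∀ {i : ℕ} (_ : i ≤ t) {Gi : Subgroup G} (_ : A' ≤ Gi) (_ : Gi.index = p ^ i),
      ((⁅Gi, Gi⁆ ⊔ ⨆ I ∈ 𝓘, I ⊓ Gi) ⊔ Subgroup.closure ((fun x : G => x ^ p) '' (Gi : Set G))).relIndex Gi =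
        Nat.card (Additive A' ⧸ (Y.map (∑ l ∈ range (p ^ i), φ ^ l) ⊔ P)) := by
    intro i hi Gi hAGi hGi
    have hmul := FukudaGroup.relIndex_commutator_sup_layer_pow_mul_card hgA hgen hA'index h𝓘 hg𝓘 hi hAGi hGi
    have hcard : Nat.card A' = Nat.card ↥(Y.map (∑ l ∈ range (p ^ i), φ ^ l) ⊔ P) *
        Nat.card (Additive A' ⧸ (Y.map (∑ l ∈ range (p ^ i), φ ^ l) ⊔ P)) :=
      Submodule.card_eq_card_quotient_mul_card (Y.map (∑ l ∈ range (p ^ i), φ ^ l) ⊔ P)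
    rw [hcard, mul_comm (Nat.card ↥(Y.map _ ⊔ P))] at hmul
    exact Nat.eq_of_mul_eq_mul_right Nat.card_pos hmul
  -- ### `#(A/Y) = p` from `e_n = 1`
  obtain ⟨G0, hAG0, hG0, he0, -⟩ := hlayer 0 (Nat.zero_le _)
  have hY1 : Nat.card (Additive A' ⧸ Y) = p := by
    have h := hquotE (Nat.zero_le _) hAG0 hG0
    rw [he0, Nat.add_zero, h0, pow_one, pow_zero, range_one, sum_singleton, pow_zero, Module.End.one_eq_id,
      Submodule.map_id] at h
    exact h.symm
  -- ### `TA ⊆ Y` and `#(A/TA) = #A^g ≤ p`, hence `Y = TA`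
  have hTY : (⊤ : Submodule ℤ (Additive A')).map (φ - 1) ≤ Y := by
    rintro _ ⟨x, -, rfl⟩
    exact FukudaGroup.map_sub_one_mem_subOf_commutator_sup hgA hgen hA'index h𝓘 hg𝓘 x
  have hfixσ : ¬ p ^ 2 ∣ Nat.card {c : ClassGroup (𝓞 (κ.layer (n + t))) // ClassGroup.mulEquiv (AmbiguousClass.intAut σ) c = c} := by
    rwa [card_fixed_eq_card_fixed_of_generator'
      (fun τ : (κ.layer (n + t)) ≃ₐ[K] (κ.layer (n + t)) =>
        ∀ y : κ.layer (n + t), ((y : κ.layer (n + t)) : AlgebraicClosure K) ∈ κ.layer n → τ y = y) σ hσfix hσgen] at hfix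
  have hTA : Nat.card (Additive A' ⧸ (⊤ : Submodule ℤ (Additive A')).map (φ - 1)) ≤ p := by
    -- `#(A/TA) = #ker(φ − 1) = #{a : g a g⁻¹ = a} = p^{v_p #fix} ≤ p`
    have hconj : ∀ x : Additive A', ((Additive.toMul (φ x) : A') : G) = g * ((Additive.toMul x : A') : G) * g⁻¹ :=
      fun _ => rfl
    have hiff : ∀ x : Additive A', x ∈ LinearMap.ker (φ - 1) ↔
        g * ((Additive.toMul x : A') : G) * g⁻¹ = ((Additive.toMul x : A') : G) := by
      intro x
      rw [LinearMap.mem_ker, LinearMap.sub_apply, Module.End.one_apply, sub_eq_zero, ← hconj]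
      constructor
      · intro h; rw [h]
      · intro h; exact Additive.toMul.injective (Subtype.ext h)
    have e : LinearMap.ker (φ - 1) ≃ {a : A' // g * (a : G) * g⁻¹ = a} :=
      { toFun := fun x => ⟨Additive.toMul (x : Additive A'), (hiff x.1).mp x.2⟩
        invFun := fun a => ⟨Additive.ofMul a.1, (hiff _).mpr a.2⟩
        left_inv := fun _ => rfl
        right_inv := fun _ => rfl }
    rw [Submodule.map_top, card_quotient_range_eq_card_ker'' (φ - 1), Nat.card_congr e, hcount]
    have hne : Nat.card {c : ClassGroup (𝓞 (κ.layer (n + t))) // ClassGroup.mulEquiv (AmbiguousClass.intAut σ) c = c} ≠ 0 := by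
      haveI : Nonempty {c : ClassGroup (𝓞 (κ.layer (n + t))) // ClassGroup.mulEquiv (AmbiguousClass.intAut σ) c = c} :=
        ⟨⟨1, map_one _⟩⟩
      exact Nat.card_pos.ne'
    have hv : padicValNat p (Nat.card {c : ClassGroup (𝓞 (κ.layer (n + t))) //
        ClassGroup.mulEquiv (AmbiguousClass.intAut σ) c = c}) ≤ 1 := by
      by_contra hlt
      push Not at hlt
      exact hfixσ ((padicValNat_dvd_iff_le hne).mpr hlt)
    calc p ^ padicValNat p (Nat.card {c : ClassGroup (𝓞 (κ.layer (n + t))) // ClassGroup.mulEquiv (AmbiguousClass.intAut σ) c = c})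
        ≤ p ^ 1 := Nat.pow_le_pow_right hp.out.pos hv
      _ = p := pow_one p
  have hYT : Y = (⊤ : Submodule ℤ (Additive A')).map (φ - 1) := by
    symm
    refine FukudaElementary.eq_of_le_of_card_quotient_le hTY ?_
    rw [hY1]; exact hTA
  -- the layers read `Y.map ν_j = (⊤).map (ν_j * T)`
  have hYν : ∀ j : ℕ, Y.map (∑ l ∈ range (p ^ j), φ ^ l) =
      (⊤ : Submodule ℤ (Additive A')).map ((∑ l ∈ range (p ^ j), φ ^ l) * (φ - 1)) := by
    intro j; rw [hYT, Module.End.mul_eq_comp, Submodule.map_comp]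
  -- ### the algebra
  have h1' : Nat.card (Additive A' ⧸ (⊤ : Submodule ℤ (Additive A')).map (φ - 1)) ≤ p := hTA
  obtain ⟨Gk, hAGk, hGk, hek, hrk⟩ := hlayer k hkt
  obtain ⟨Gm, hAGm, hGm, -, hrm⟩ := hlayer m hmt
  have hEk := hquotE hkt hAGk hGk
  have hRk := hquotR hkt hAGk hGk
  rw [hYν] at hEk hRk
  -- `r_{n+k} ≤ p^k` always (so the third alternative implies the first)
  have hrk_le : classGroupPRank κ (n + k) ≤ p ^ k := by
    have h := FukudaElementary.card_quotient_sup_sub_one_le_pow (p := p) φ h1' k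
    rw [← hRk, hrk] at h
    exact (Nat.pow_le_pow_iff_right hp1).mp h
  have hk2 : classGroupPRank κ (n + k) < classNumberPExp κ (n + k) ∨ classGroupPRank κ (n + k) < p ^ k := by
    rcases hk with h | h | h
    · exact Or.inl h
    · exact Or.inr h
    · exact Or.inl (lt_of_le_of_lt hrk_le h)
  have hbound : Nat.card (Additive A' ⧸ P) ≤ p ^ (p ^ k - 1) := by
    rcases hk2 with hk | hk
    · have hk' : Nat.card (Additive A' ⧸ ((⊤ : Submodule ℤ (Additive A')).map ((∑ l ∈ range (p ^ k), φ ^ l) * (φ - 1)) ⊔ P)) <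
          Nat.card (Additive A' ⧸ (⊤ : Submodule ℤ (Additive A')).map ((∑ l ∈ range (p ^ k), φ ^ l) * (φ - 1))) := by
        rw [← hEk, ← hRk, hek, hrk]
        exact Nat.pow_lt_pow_right hp1 hk
      exact FukudaElementary.card_quotient_smul_le_of_card_quotient_sub_one_le hM φ hφt h1' hk'
    · have hk' : Nat.card (Additive A' ⧸ ((⊤ : Submodule ℤ (Additive A')).map ((∑ l ∈ range (p ^ k), φ ^ l) * (φ - 1)) ⊔ P)) <
          p ^ (p ^ k) := by
        rw [← hRk, hrk]
        exact Nat.pow_lt_pow_right hp1 hk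
      exact FukudaElementary.card_quotient_smul_le_of_card_quotient_sup_lt_pow φ hφt h1' hk'
  have hrm' : p ^ classGroupPRank κ (n + m) ≤ p ^ (p ^ k - 1) := by
    have hR := hquotR hmt hAGm hGm
    rw [hrm] at hR
    rw [hR]
    exact (MuZeroRank.card_quotient_le_of_le le_sup_right).trans hbound
  exact (Nat.pow_le_pow_iff_right hp1).mp hrm'

/-! ## §2 The door along the tower -/

/-- ★★★ **THE ELEMENTARY-LAYER DOOR OVER A LAYER WITH `ord_p h(K_n) = 1`.**  `κ` a `ℤ_p`-extension of the number field `K` with Fukuda index `n₀ ≤ n`,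
`ord_p h(K_n) = 1` (`e_n = 1`), and at the layer `K_{n+k+1}`: `p²` does NOT divide the number of classes fixed by `Gal(K_{n+k+1}/K_n)`.  If
`rank_p Cl(K_{n+k}) < ord_p h(K_{n+k})` (the `p`-class group of `K_{n+k}` is NOT elementary abelian), OR `rank_p Cl(K_{n+k}) < p^k`, OR `p^k < ord_p h(K_{n+k})`, then
**`rank_p Cl(K_{n+m}) ≤ p^k − 1` for every `m`** (`r_{n+k+1} ≤ p^k − 1 < p^{k+1} − 1` and door L10). [cite: Washington1997, §13.3 Lemma 13.18 and Prop. 13.22–13.23]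
[cite: Fukuda1994, Thm. 1 (proof, p. 264)] [cite: NeukirchANT1999, Ch. VI §7 Thm. (7.1)] -/
theorem classGroupPRank_add_le_of_not_sq_dvd_card_fixed (κ : ZpExtension K p) {n₀ n : ℕ} (hκ : TotallyRamifiedFrom κ n₀) (hn : n₀ ≤ n)
    (h0 : classNumberPExp κ n = 1) {k : ℕ}
    (hfix : ¬ p ^ 2 ∣ Nat.card {c : ClassGroup (𝓞 (κ.layer (n + (k + 1)))) //
        ∀ τ : (κ.layer (n + (k + 1))) ≃ₐ[K] (κ.layer (n + (k + 1))),
          (∀ y : κ.layer (n + (k + 1)), ((y : κ.layer (n + (k + 1))) : AlgebraicClosure K) ∈ κ.layer n → τ y = y) →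
            ClassGroup.mulEquiv (AmbiguousClass.intAut τ) c = c})
    (hk : classGroupPRank κ (n + k) < classNumberPExp κ (n + k) ∨ classGroupPRank κ (n + k) < p ^ k ∨
      p ^ k < classNumberPExp κ (n + k)) (m : ℕ) :
    classGroupPRank κ (n + m) ≤ p ^ k - 1 := by
  have hp1 : 1 < p := hp.out.one_lt
  have hk1 : classGroupPRank κ (n + (k + 1)) ≤ p ^ k - 1 :=
    layer_subOne κ hκ hn h0 (t := k + 1) (by omega) hfix (k := k) (Nat.le_succ k) hk (m := k + 1) le_rfl
  have hsmall : classGroupPRank κ (n + (k + 1)) < p ^ (k + 1) - 1 := by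
    have h1 : 1 ≤ p ^ k := Nat.one_le_pow _ _ hp.out.pos
    have h2 : p ^ k < p ^ (k + 1) := Nat.pow_lt_pow_right hp1 (by omega)
    omega
  exact (classGroupPRank_le_of_lt_pow_sub_one κ hκ hn hsmall m).trans hk1

/-- **`μ = 0` and `λ ≤ p^k − 1`** under the hypotheses of `classGroupPRank_add_le_of_not_sq_dvd_card_fixed` (tree: bounded ranks from layer `n` on).
[cite: Washington1997, §13.3 Prop. 13.23] [cite: Fukuda1994, Thm. 1 (2), p. 264] -/
theorem classicalMuVanishes_and_classicalLambda_le_of_not_sq_dvd_card_fixed (κ : ZpExtension K p) {n₀ n : ℕ}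
    (hκ : TotallyRamifiedFrom κ n₀) (hn : n₀ ≤ n) (h0 : classNumberPExp κ n = 1) {k : ℕ}
    (hfix : ¬ p ^ 2 ∣ Nat.card {c : ClassGroup (𝓞 (κ.layer (n + (k + 1)))) //
        ∀ τ : (κ.layer (n + (k + 1))) ≃ₐ[K] (κ.layer (n + (k + 1))),
          (∀ y : κ.layer (n + (k + 1)), ((y : κ.layer (n + (k + 1))) : AlgebraicClosure K) ∈ κ.layer n → τ y = y) →
            ClassGroup.mulEquiv (AmbiguousClass.intAut τ) c = c})
    (hk : classGroupPRank κ (n + k) < classNumberPExp κ (n + k) ∨ classGroupPRank κ (n + k) < p ^ k ∨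
      p ^ k < classNumberPExp κ (n + k)) :
    ClassicalMuVanishes κ ∧ classicalLambda κ ≤ p ^ k - 1 := by
  refine classicalLambda_le_of_forall_classGroupPRank_le κ hκ hn fun m hm => ?_
  obtain ⟨m', rfl⟩ := Nat.exists_eq_add_of_le hm
  exact classGroupPRank_add_le_of_not_sq_dvd_card_fixed κ hκ hn h0 hfix hk m'

/-- ★★★ **THE CLASS-NUMBER TEST over a layer with `ord_p h(K_n) = 1`.**  Fukuda index `n₀ ≤ n`, `e_n = 1`, `p² ∤ #Cl(K_{n+k+1})^{Gal(K_{n+k+1}/K_n)}`: **`ord_p h(K_{n+k}) ≠ p^k`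
⟹ `rank_p Cl(K_{n+m}) ≤ p^k − 1 ∀ m`, `μ = 0`, `λ ≤ p^k − 1`** (`e < p^k ⟹ r ≤ e < p^k`; `e > p^k` is the third alternative).  Contrapositive: `μ > 0` forces
`ord_p h(K_{n+k}) = rank_p Cl(K_{n+k}) = p^k` at every such layer. [cite: Washington1997, §13.3 Prop. 13.22–13.23] [cite: Fukuda1994, Thm. 1 and its proof, p. 264] -/
theorem classicalMuVanishes_and_classicalLambda_le_of_classNumberPExp_ne_pow (κ : ZpExtension K p) {n₀ n : ℕ} (hκ : TotallyRamifiedFrom κ n₀)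
    (hn : n₀ ≤ n) (h0 : classNumberPExp κ n = 1) {k : ℕ}
    (hfix : ¬ p ^ 2 ∣ Nat.card {c : ClassGroup (𝓞 (κ.layer (n + (k + 1)))) //
        ∀ τ : (κ.layer (n + (k + 1))) ≃ₐ[K] (κ.layer (n + (k + 1))),
          (∀ y : κ.layer (n + (k + 1)), ((y : κ.layer (n + (k + 1))) : AlgebraicClosure K) ∈ κ.layer n → τ y = y) →
            ClassGroup.mulEquiv (AmbiguousClass.intAut τ) c = c})
    (hk : classNumberPExp κ (n + k) ≠ p ^ k) :
    (∀ m, classGroupPRank κ (n + m) ≤ p ^ k - 1) ∧ ClassicalMuVanishes κ ∧ classicalLambda κ ≤ p ^ k - 1 := by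
  have hk' : classGroupPRank κ (n + k) < classNumberPExp κ (n + k) ∨ classGroupPRank κ (n + k) < p ^ k ∨
      p ^ k < classNumberPExp κ (n + k) := by
    rcases lt_or_gt_of_ne hk with hlt | hgt
    · exact Or.inr (Or.inl (lt_of_le_of_lt (classGroupPRank_le_classNumberPExp κ (n + k)) hlt))
    · exact Or.inr (Or.inr hgt)
  exact ⟨classGroupPRank_add_le_of_not_sq_dvd_card_fixed κ hκ hn h0 hfix hk',
    classicalMuVanishes_and_classicalLambda_le_of_not_sq_dvd_card_fixed κ hκ hn h0 hfix hk'⟩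

/-- The door from ONE class of order `p²` in `Cl(K_{n+k})` (dictionary `classGroupPRank_lt_classNumberPExp_of_orderOf_eq_sq` of the companion file).
[cite: Washington1997, §13.3 Prop. 13.22–13.23] [cite: Fukuda1994, Thm. 1, p. 264] -/
theorem classicalMuVanishes_and_classicalLambda_le_of_orderOf_eq_sq_of_not_sq_dvd_card_fixed (κ : ZpExtension K p) {n₀ n : ℕ}
    (hκ : TotallyRamifiedFrom κ n₀) (hn : n₀ ≤ n) (h0 : classNumberPExp κ n = 1) {k : ℕ}
    (hfix : ¬ p ^ 2 ∣ Nat.card {c : ClassGroup (𝓞 (κ.layer (n + (k + 1)))) //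
        ∀ τ : (κ.layer (n + (k + 1))) ≃ₐ[K] (κ.layer (n + (k + 1))),
          (∀ y : κ.layer (n + (k + 1)), ((y : κ.layer (n + (k + 1))) : AlgebraicClosure K) ∈ κ.layer n → τ y = y) →
            ClassGroup.mulEquiv (AmbiguousClass.intAut τ) c = c})
    {c : ClassGroup (𝓞 (κ.layer (n + k)))} (hc : orderOf c = p ^ 2) :
    (∀ m, classGroupPRank κ (n + m) ≤ p ^ k - 1) ∧ ClassicalMuVanishes κ ∧ classicalLambda κ ≤ p ^ k - 1 :=
  have hk : classGroupPRank κ (n + k) < classNumberPExp κ (n + k) ∨ classGroupPRank κ (n + k) < p ^ k ∨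
      p ^ k < classNumberPExp κ (n + k) :=
    Or.inl (classGroupPRank_lt_classNumberPExp_of_orderOf_eq_sq κ hc)
  ⟨classGroupPRank_add_le_of_not_sq_dvd_card_fixed κ hκ hn h0 hfix hk,
    classicalMuVanishes_and_classicalLambda_le_of_not_sq_dvd_card_fixed κ hκ hn h0 hfix hk⟩

/-- The ambiguous-class hypothesis in the shape a Chevalley count delivers it: the classes fixed by ALL `K`-automorphisms of `K_{k+1}` (every `K`-automorphism fixes
`K_0 = K` pointwise). [cite: Lang1990, Ch. 13 §4 Lemma 4.1] -/
theorem card_fixed_layer_eq (κ : ZpExtension K p) (m : ℕ) [Finite ((κ.layer m) ≃ₐ[K] (κ.layer m))] :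
    Nat.card {c : ClassGroup (𝓞 (κ.layer m)) //
        ∀ τ : (κ.layer m) ≃ₐ[K] (κ.layer m),
          (∀ y : κ.layer m, ((y : κ.layer m) : AlgebraicClosure K) ∈ κ.layer 0 → τ y = y) →
            ClassGroup.mulEquiv (AmbiguousClass.intAut τ) c = c} =
      Nat.card {c : ClassGroup (𝓞 (κ.layer m)) // ∀ τ : (κ.layer m) ≃ₐ[K] (κ.layer m), ClassGroup.mulEquiv (AmbiguousClass.intAut τ) c = c} :=
  Nat.card_congr (Equiv.subtypeEquivRight fun _ =>
    ⟨fun h τ => h τ fun y hy => forall_apply_eq_of_mem_layer_zero' κ m τ y hy, fun h τ _ => h τ⟩)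

end Literature.NumberTheory.IwasawaTheory

end
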